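import Mathlib
import Literature.Probability.LatticeModels.ConformalCovariance
import Summits.CriticalPhenomena.Ising3DConformalLimit.Theorems.PrecisionLaplacianMoebiusLimitOfTwoPointLawSphereInversionCoV
import Summits.CriticalPhenomena.Ising3DConformalLimit.Theorems.PrecisionLaplacianMoebiusLimitOfTwoPointLawInversionBegetsRotations
import HarnessLib

/-!
# SCT covariance from the Ward identity — algebra and calculus of the unit inversion (stub A helper,
line `multipole-ward-nonsat-endpoint`, crux `MoebiusLimitOfTwoPointLaw`, item stmt-CriticalPhenomena-4801)

Write `ι y = ‖y‖⁻² y` for the unit inversion of `ℝ³` and `Φ y = (ι yᵢ)ᵢ` for its product action on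
configurations. This file collects the pointwise facts behind `K = ι P ι`:

* `sctA_norm_sq_inv_add` : `‖ι x + a‖² = (1 + 2⟪a,x⟫ + ‖a‖²‖x‖²)/‖x‖²`;
* `sctA_inv_inv_add` : `ι (ι x + a) = (1 + 2⟪a,x⟫ + ‖a‖²‖x‖²)⁻¹ (x + ‖x‖² a)` (the finite special conformal map);
* `sctA_fderiv_inv_apply_sctField` : `Dι(x)[‖x‖²a − 2⟪a,x⟫x] = a` (the SCT vector field is `ι_* ∂_a`);
* `sctA_hasFDerivAt_weight` : the derivative of the weight `∏ (‖xⱼ‖²)^(Δ−3)` along the SCT field is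
  `−(2Δ−6)(Σ⟪a,xⱼ⟫)` times the weight.

References: Di Francesco–Mathieu–Sénéchal 1997 §4.1 (4.15)–(4.18) [FrancescoMathieuSenechal1997].
-/

noncomputable section

namespace Summit.CriticalPhenomena.Ising3DConformalLimit.PrecisionLaplacianMoebiusLimitOfTwoPointLaw

open Literature.Probability.LatticeModels Filter Topology MeasureTheory EuclideanGeometry
open Summit.CriticalPhenomena.Ising3DConformalLimit.Theorems.MoebiusLimitOfTwoPointLaw.Negative
  (norm_sphereInversion sphereInversion_injective)

/-! ## Pointwise algebra of `ι` -/

/-- `‖ι x + a‖² · ‖x‖² = 1 + 2⟪a,x⟫ + ‖a‖²‖x‖²` for `x ≠ 0`. -/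
theorem sctA_norm_sq_inv_add {x : EuclideanSpace ℝ (Fin 3)} (hx : x ≠ 0) (a : EuclideanSpace ℝ (Fin 3)) :
    ‖(1 / ‖x‖ ^ 2) • x + a‖ ^ 2 = (1 + 2 * inner ℝ a x + ‖a‖ ^ 2 * ‖x‖ ^ 2) / ‖x‖ ^ 2 := by
  have hn : 0 < ‖x‖ := norm_pos_iff.2 hx
  have hn2 : (‖x‖ ^ 2 : ℝ) ≠ 0 := by positivity
  rw [norm_add_sq_real, norm_smul, real_inner_smul_left, real_inner_comm x a, Real.norm_eq_abs,
    abs_of_nonneg (by positivity : (0:ℝ) ≤ 1 / ‖x‖ ^ 2)]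
  field_simp

/-- The SCT denominator is positive on pole-free configurations: if `x ≠ 0` then
`1 + 2⟪a,x⟫ + ‖a‖²‖x‖² = ‖ι x + a‖² ‖x‖² ≥ 0`, and it is nonzero by hypothesis. -/
theorem sctA_sigma_pos {x : EuclideanSpace ℝ (Fin 3)} (hx : x ≠ 0) {a : EuclideanSpace ℝ (Fin 3)}
    (h : 1 + 2 * inner ℝ a x + ‖a‖ ^ 2 * ‖x‖ ^ 2 ≠ 0) :
    0 < 1 + 2 * inner ℝ a x + ‖a‖ ^ 2 * ‖x‖ ^ 2 := by
  have hn : 0 < ‖x‖ := norm_pos_iff.2 hx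
  have key : 1 + 2 * inner ℝ a x + ‖a‖ ^ 2 * ‖x‖ ^ 2 = ‖(1 / ‖x‖ ^ 2) • x + a‖ ^ 2 * ‖x‖ ^ 2 := by
    rw [sctA_norm_sq_inv_add hx a]
    field_simp
  rcases (key ▸ (by positivity : (0:ℝ) ≤ ‖(1 / ‖x‖ ^ 2) • x + a‖ ^ 2 * ‖x‖ ^ 2)).lt_or_eq with hlt | heq
  · exact hlt
  · exact absurd heq.symm h

/-- `ι (ι x + a)` is the finite special conformal map `x ↦ (x + ‖x‖²a)/(1 + 2⟪a,x⟫ + ‖a‖²‖x‖²)`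
(for `x ≠ 0` with nonvanishing denominator). -/
theorem sctA_inv_inv_add {x : EuclideanSpace ℝ (Fin 3)} (hx : x ≠ 0) {a : EuclideanSpace ℝ (Fin 3)}
    (h : 1 + 2 * inner ℝ a x + ‖a‖ ^ 2 * ‖x‖ ^ 2 ≠ 0) :
    (1 / ‖(1 / ‖x‖ ^ 2) • x + a‖ ^ 2) • ((1 / ‖x‖ ^ 2) • x + a) =
      (1 + 2 * inner ℝ a x + ‖a‖ ^ 2 * ‖x‖ ^ 2)⁻¹ • (x + ‖x‖ ^ 2 • a) := by
  have hn : 0 < ‖x‖ := norm_pos_iff.2 hx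
  have hn2 : (‖x‖ ^ 2 : ℝ) ≠ 0 := by positivity
  rw [sctA_norm_sq_inv_add hx a, smul_add, smul_add, smul_smul, smul_smul]
  congr 1
  · congr 1
    field_simp
  · congr 1
    field_simp

/-- The derivative of `ι` at `x ≠ 0` applied to the SCT vector field `‖x‖²a − 2⟪a,x⟫x` is the constant
vector `a` (`K_a = ι_* P_a`). -/
theorem sctA_fderiv_inv_apply_sctField {x : EuclideanSpace ℝ (Fin 3)} (hx : x ≠ 0)
    (a : EuclideanSpace ℝ (Fin 3)) :
    ((1 : ℝ) • ((1 / dist x 0) ^ 2 •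
        ((ℝ ∙ (x - 0))ᗮ.reflection : EuclideanSpace ℝ (Fin 3) →L[ℝ] EuclideanSpace ℝ (Fin 3))))
      (‖x‖ ^ 2 • a - (2 * inner ℝ a x) • x) = a := by
  have hn : 0 < ‖x‖ := norm_pos_iff.2 hx
  have hn2 : (‖x‖ ^ 2 : ℝ) ≠ 0 := by positivity
  rw [one_smul, sub_zero, FunLike.coe_smul, Pi.smul_apply, dist_zero_right]
  change (1 / ‖x‖) ^ 2 • (ℝ ∙ x)ᗮ.reflection (‖x‖ ^ 2 • a - (2 * inner ℝ a x) • x) = a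
  rw [reflection_orthogonal_singleton_eq]
  have hin : inner ℝ (‖x‖ ^ 2 • a - (2 * inner ℝ a x) • x) x = -(‖x‖ ^ 2 * inner ℝ a x) := by
    rw [inner_sub_left, real_inner_smul_left, real_inner_smul_left, real_inner_self_eq_norm_sq]
    ring
  rw [hin]
  have e : ‖x‖ ^ 2 • a - (2 * inner ℝ a x) • x - (2 * -(‖x‖ ^ 2 * inner ℝ a x) / ‖x‖ ^ 2) • x =
      ‖x‖ ^ 2 • a := by
    have : 2 * -(‖x‖ ^ 2 * inner ℝ a x) / ‖x‖ ^ 2 = -(2 * inner ℝ a x) := by field_simp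
    rw [this, neg_smul, sub_neg_eq_add, sub_add_cancel]
  rw [e, smul_smul]
  have : (1 / ‖x‖) ^ 2 * ‖x‖ ^ 2 = 1 := by field_simp
  rw [this, one_smul]

/-! ## Calculus: the weight and the transported test function -/

/-- Derivative of the weight `∏ⱼ (‖xⱼ‖²)^(Δ−3)` at an off-origin configuration, evaluated on the SCT field
`(‖xᵢ‖²a − 2⟪a,xᵢ⟫xᵢ)ᵢ`: it is `−(2Δ−6)(Σᵢ⟪a,xᵢ⟫)` times the weight. -/
theorem sctA_hasFDerivAt_weight (n : ℕ) (Δ : ℝ) (a : EuclideanSpace ℝ (Fin 3))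
    {x : Fin n → EuclideanSpace ℝ (Fin 3)} (hx : ∀ i, x i ≠ 0) :
    ∃ L : (Fin n → EuclideanSpace ℝ (Fin 3)) →L[ℝ] ℝ,
      HasFDerivAt (fun y : Fin n → EuclideanSpace ℝ (Fin 3) => ∏ j, (‖y j‖ ^ 2) ^ (Δ - 3)) L x ∧
      L (fun i => ‖x i‖ ^ 2 • a - (2 * inner ℝ a (x i)) • x i) =
        -((2 * Δ - 6) * ∑ i, inner ℝ a (x i)) * ∏ j, (‖x j‖ ^ 2) ^ (Δ - 3) := by
  classical
  -- derivative of each factor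
  have hfac : ∀ j ∈ (Finset.univ : Finset (Fin n)),
      HasFDerivAt (fun y : Fin n → EuclideanSpace ℝ (Fin 3) => (‖y j‖ ^ 2) ^ (Δ - 3))
        (((Δ - 3) * (‖x j‖ ^ 2) ^ (Δ - 3 - 1)) •
          ((2 : ℕ) • ((innerSL ℝ (x j)).comp
            (ContinuousLinearMap.proj (R := ℝ) (φ := fun _ : Fin n => EuclideanSpace ℝ (Fin 3)) j)))) x := by
    intro j _
    have h1 : HasFDerivAt (fun y : Fin n → EuclideanSpace ℝ (Fin 3) => y j)
        (ContinuousLinearMap.proj (R := ℝ) (φ := fun _ : Fin n => EuclideanSpace ℝ (Fin 3)) j) x :=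
      hasFDerivAt_apply j x
    have h2 := h1.norm_sq
    have hne : ‖x j‖ ^ 2 ≠ 0 := by
      have := norm_pos_iff.2 (hx j); positivity
    exact h2.rpow_const (Or.inl hne)
  refine ⟨_, HasFDerivAt.finsetProd hfac, ?_⟩
  rw [_root_.sum_apply,
    show -((2 * Δ - 6) * ∑ i, inner ℝ a (x i)) * ∏ j, (‖x j‖ ^ 2) ^ (Δ - 3) =
        ∑ i, -((2 * Δ - 6) * inner ℝ a (x i) * ∏ j, (‖x j‖ ^ 2) ^ (Δ - 3)) by
      rw [Finset.mul_sum, ← Finset.sum_neg_distrib, Finset.sum_mul]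
      simp only [neg_mul]]
  refine Finset.sum_congr rfl fun i _ => ?_
  rw [_root_.smul_apply, _root_.smul_apply, _root_.smul_apply, ContinuousLinearMap.comp_apply]
  simp only [ContinuousLinearMap.proj_apply, innerSL_apply_apply, smul_eq_mul, nsmul_eq_mul, Nat.cast_ofNat]
  have hin : inner ℝ (x i) (‖x i‖ ^ 2 • a - (2 * inner ℝ a (x i)) • x i) = -(‖x i‖ ^ 2 * inner ℝ a (x i)) := by
    rw [inner_sub_right, real_inner_smul_right, real_inner_smul_right, real_inner_self_eq_norm_sq,
      real_inner_comm (x i) a]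
    ring
  rw [hin]
  have hr : (0 : ℝ) < ‖x i‖ ^ 2 := by have := norm_pos_iff.2 (hx i); positivity
  have hpow : (‖x i‖ ^ 2) ^ (Δ - 3 - 1) * ‖x i‖ ^ 2 = (‖x i‖ ^ 2) ^ (Δ - 3) := by
    rw [Real.rpow_sub_one hr.ne', div_mul_cancel₀ _ hr.ne']
  rw [← Finset.mul_prod_erase Finset.univ (fun j => (‖x j‖ ^ 2) ^ (Δ - 3)) (Finset.mem_univ i)]
  rw [← hpow]
  ring

/-- The product inversion `Φ` evaluated on the SCT field: `DΦ(x)[(‖xᵢ‖²a − 2⟪a,xᵢ⟫xᵢ)ᵢ] = (a,…,a)`. -/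
theorem sctA_fderiv_prodInv_apply_sctField (n : ℕ) (a : EuclideanSpace ℝ (Fin 3))
    {x : Fin n → EuclideanSpace ℝ (Fin 3)} (hx : ∀ i, x i ≠ 0) :
    (ContinuousLinearMap.pi fun i =>
        ((1 : ℝ) • ((1 / dist (x i) 0) ^ 2 • ((ℝ ∙ (x i - 0))ᗮ.reflection :
          EuclideanSpace ℝ (Fin 3) →L[ℝ] EuclideanSpace ℝ (Fin 3)))).comp (ContinuousLinearMap.proj i))
      (fun i => ‖x i‖ ^ 2 • a - (2 * inner ℝ a (x i)) • x i) = fun _ => a := by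
  funext i
  rw [ContinuousLinearMap.pi_apply, ContinuousLinearMap.comp_apply]
  exact sctA_fderiv_inv_apply_sctField (hx i) a

/-- **Transport of test functions (`K = ιPι`, pointwise).** For `ψ` differentiable and `x` off the origin,
the function `φ(x) = (∏ⱼ (‖xⱼ‖²)^(Δ−3)) ψ(Φ x)` satisfies
`(2Δ−6)(Σ⟪a,xᵢ⟫) φ(x) + Dφ(x)[(‖xᵢ‖²a − 2⟪a,xᵢ⟫xᵢ)ᵢ] = (∏ⱼ (‖xⱼ‖²)^(Δ−3)) · Dψ(Φ x)[(a,…,a)]`. -/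
theorem sctA_transport_pointwise (n : ℕ) (Δ : ℝ) (a : EuclideanSpace ℝ (Fin 3))
    {ψ : (Fin n → EuclideanSpace ℝ (Fin 3)) → ℝ} (hψ : Differentiable ℝ ψ)
    {x : Fin n → EuclideanSpace ℝ (Fin 3)} (hx : ∀ i, x i ≠ 0) :
    (2 * Δ - 6) * (∑ i, inner ℝ a (x i)) *
        ((∏ j, (‖x j‖ ^ 2) ^ (Δ - 3)) * ψ (fun i => (1 / ‖x i‖ ^ 2) • x i)) +
      fderiv ℝ (fun y : Fin n → EuclideanSpace ℝ (Fin 3) =>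
        (∏ j, (‖y j‖ ^ 2) ^ (Δ - 3)) * ψ (fun i => (1 / ‖y i‖ ^ 2) • y i)) x
        (fun i => ‖x i‖ ^ 2 • a - (2 * inner ℝ a (x i)) • x i) =
      (∏ j, (‖x j‖ ^ 2) ^ (Δ - 3)) *
        fderiv ℝ ψ (fun i => (1 / ‖x i‖ ^ 2) • x i) (fun _ => a) := by
  obtain ⟨L, hL, hLW⟩ := sctA_hasFDerivAt_weight n Δ a hx
  have hΦ := hasFDerivAt_prodSphereInversion n 1 hx
  have hψΦ : HasFDerivAt (fun y : Fin n → EuclideanSpace ℝ (Fin 3) => ψ (fun i => (1 / ‖y i‖ ^ 2) • y i))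
      ((fderiv ℝ ψ (fun i => (1 / ‖x i‖ ^ 2) • x i)).comp
        (ContinuousLinearMap.pi fun i =>
          ((1 : ℝ) • ((1 / dist (x i) 0) ^ 2 • ((ℝ ∙ (x i - 0))ᗮ.reflection :
            EuclideanSpace ℝ (Fin 3) →L[ℝ] EuclideanSpace ℝ (Fin 3)))).comp (ContinuousLinearMap.proj i))) x :=
    (hψ _).hasFDerivAt.comp x hΦ
  have hφ : HasFDerivAt (fun y : Fin n → EuclideanSpace ℝ (Fin 3) =>
      (∏ j, (‖y j‖ ^ 2) ^ (Δ - 3)) * ψ (fun i => (1 / ‖y i‖ ^ 2) • y i)) _ x := hL.mul hψΦ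
  rw [hφ.fderiv]
  rw [_root_.add_apply, _root_.smul_apply, _root_.smul_apply,
    ContinuousLinearMap.comp_apply, sctA_fderiv_prodInv_apply_sctField n a hx, hLW]
  simp only [smul_eq_mul]
  ring

/-! ## The product inversion `Φ` on off-origin configurations -/

/-- `Φ` maps off-origin configurations to off-origin configurations. -/
theorem sctA_prodInv_ne_zero {n : ℕ} {x : Fin n → EuclideanSpace ℝ (Fin 3)} (hx : ∀ i, x i ≠ 0) (i : Fin n) :
    (1 / ‖x i‖ ^ 2) • x i ≠ 0 :=
  sphereInversion_ne_zero one_pos (hx i)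

/-- `Φ ∘ Φ = id` on off-origin configurations. -/
theorem sctA_prodInv_prodInv {n : ℕ} {x : Fin n → EuclideanSpace ℝ (Fin 3)} (hx : ∀ i, x i ≠ 0) :
    (fun i => (1 / ‖(1 / ‖x i‖ ^ 2) • x i‖ ^ 2) • (1 / ‖x i‖ ^ 2) • x i) = x :=
  funext fun i => sphereInversion_sphereInversion one_pos (hx i)

/-- If some point of `x` is the origin, the same holds for `Φ x` (Lean's `1/0 = 0`). -/
theorem sctA_prodInv_not_mem {n : ℕ} {x : Fin n → EuclideanSpace ℝ (Fin 3)}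
    (hx : ¬ ∀ i, x i ≠ 0) : ¬ ∀ i, (1 / ‖x i‖ ^ 2) • x i ≠ 0 := by
  intro h
  exact hx fun i hi => h i (by rw [hi, smul_zero])

/-- `Φ` is continuous on the open set of off-origin configurations. -/
theorem sctA_continuousOn_prodInv (n : ℕ) :
    ContinuousOn (fun (x : Fin n → EuclideanSpace ℝ (Fin 3)) i => (1 / ‖x i‖ ^ 2) • x i)
      {x | ∀ i, x i ≠ 0} := by
  refine continuousOn_pi.2 fun i => ?_
  have h1 : ContinuousOn (fun x : Fin n → EuclideanSpace ℝ (Fin 3) => x i) {x | ∀ i, x i ≠ 0} :=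
    (continuous_apply i).continuousOn
  have h2 : ContinuousOn (fun x : Fin n → EuclideanSpace ℝ (Fin 3) => 1 / ‖x i‖ ^ 2) {x | ∀ i, x i ≠ 0} := by
    refine continuousOn_const.div (h1.norm.pow 2) fun x hx => ?_
    have := norm_pos_iff.2 (hx i)
    positivity
  exact h2.smul h1

/-- `Φ` is smooth at every off-origin configuration. -/
theorem sctA_contDiffAt_prodInv {n : ℕ} {x : Fin n → EuclideanSpace ℝ (Fin 3)} (hx : ∀ i, x i ≠ 0) :
    ContDiffAt ℝ ((⊤ : ℕ∞) : WithTop ℕ∞)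
      (fun (y : Fin n → EuclideanSpace ℝ (Fin 3)) i => (1 / ‖y i‖ ^ 2) • y i) x := by
  refine contDiffAt_pi.2 fun i => ?_
  have h1 : ContDiffAt ℝ ((⊤ : ℕ∞) : WithTop ℕ∞) (fun y : Fin n → EuclideanSpace ℝ (Fin 3) => y i) x :=
    contDiffAt_apply ℝ (EuclideanSpace ℝ (Fin 3)) i x
  have h2 : ContDiffAt ℝ ((⊤ : ℕ∞) : WithTop ℕ∞) (fun y : Fin n → EuclideanSpace ℝ (Fin 3) => 1 / ‖y i‖ ^ 2) x := by
    refine contDiffAt_const.div (h1.norm_sq ℝ) ?_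
    have := norm_pos_iff.2 (hx i)
    positivity
  exact h2.smul h1

/-- The weight `∏ⱼ (‖yⱼ‖²)^p` is smooth at every off-origin configuration. -/
theorem sctA_contDiffAt_weight {n : ℕ} (p : ℝ) {x : Fin n → EuclideanSpace ℝ (Fin 3)} (hx : ∀ i, x i ≠ 0) :
    ContDiffAt ℝ ((⊤ : ℕ∞) : WithTop ℕ∞)
      (fun y : Fin n → EuclideanSpace ℝ (Fin 3) => ∏ j, (‖y j‖ ^ 2) ^ p) x := by
  refine contDiffAt_prod fun j _ => ?_
  have h1 : ContDiffAt ℝ ((⊤ : ℕ∞) : WithTop ℕ∞) (fun y : Fin n → EuclideanSpace ℝ (Fin 3) => y j) x :=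
    contDiffAt_apply ℝ (EuclideanSpace ℝ (Fin 3)) j x
  refine (h1.norm_sq ℝ).rpow_const_of_ne ?_
  have := norm_pos_iff.2 (hx j)
  positivity

/-- The weight is continuous on off-origin configurations. -/
theorem sctA_continuousOn_weight (n : ℕ) (p : ℝ) :
    ContinuousOn (fun y : Fin n → EuclideanSpace ℝ (Fin 3) => ∏ j, (‖y j‖ ^ 2) ^ p) {x | ∀ i, x i ≠ 0} :=
  fun _ hx => (sctA_contDiffAt_weight p hx).continuousAt.continuousWithinAt

/-! ## The transported test function `φ = weight · ψ ∘ Φ` -/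

/-- Support of the transported test function: if `φ x ≠ 0` then `x ∈ Φ '' tsupport ψ`. -/
theorem sctA_transport_support {n : ℕ} (Δ : ℝ) {ψ : (Fin n → EuclideanSpace ℝ (Fin 3)) → ℝ}
    (hψs : tsupport ψ ⊆ {x | ∀ i, x i ≠ 0}) {x : Fin n → EuclideanSpace ℝ (Fin 3)}
    (hx : (∏ j, (‖x j‖ ^ 2) ^ (Δ - 3)) * ψ (fun i => (1 / ‖x i‖ ^ 2) • x i) ≠ 0) :
    x ∈ (fun (x : Fin n → EuclideanSpace ℝ (Fin 3)) i => (1 / ‖x i‖ ^ 2) • x i) '' tsupport ψ := by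
  have hψx : ψ (fun i => (1 / ‖x i‖ ^ 2) • x i) ≠ 0 := fun h => hx (by rw [h, mul_zero])
  have hmem : (fun i => (1 / ‖x i‖ ^ 2) • x i) ∈ tsupport ψ := subset_tsupport _ hψx
  have hU : ∀ i, (1 / ‖x i‖ ^ 2) • x i ≠ 0 := hψs hmem
  have hx0 : ∀ i, x i ≠ 0 := by
    by_contra h
    exact sctA_prodInv_not_mem h hU
  exact ⟨_, hmem, sctA_prodInv_prodInv hx0⟩

/-- The image `Φ '' tsupport ψ` is compact and consists of off-origin configurations. -/
theorem sctA_image_tsupport {n : ℕ} {ψ : (Fin n → EuclideanSpace ℝ (Fin 3)) → ℝ}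
    (hψc : HasCompactSupport ψ) (hψs : tsupport ψ ⊆ {x | ∀ i, x i ≠ 0}) :
    IsCompact ((fun (x : Fin n → EuclideanSpace ℝ (Fin 3)) i => (1 / ‖x i‖ ^ 2) • x i) '' tsupport ψ) ∧
      (fun (x : Fin n → EuclideanSpace ℝ (Fin 3)) i => (1 / ‖x i‖ ^ 2) • x i) '' tsupport ψ ⊆
        {x | ∀ i, x i ≠ 0} := by
  refine ⟨hψc.image_of_continuousOn ((sctA_continuousOn_prodInv n).mono hψs), ?_⟩
  rintro _ ⟨z, hz, rfl⟩
  exact fun i => sctA_prodInv_ne_zero (hψs hz) i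

/-- The transported test function has compact support inside `Φ '' tsupport ψ`. -/
theorem sctA_transport_tsupport {n : ℕ} (Δ : ℝ) {ψ : (Fin n → EuclideanSpace ℝ (Fin 3)) → ℝ}
    (hψc : HasCompactSupport ψ) (hψs : tsupport ψ ⊆ {x | ∀ i, x i ≠ 0}) :
    tsupport (fun x : Fin n → EuclideanSpace ℝ (Fin 3) =>
        (∏ j, (‖x j‖ ^ 2) ^ (Δ - 3)) * ψ (fun i => (1 / ‖x i‖ ^ 2) • x i)) ⊆
      (fun (x : Fin n → EuclideanSpace ℝ (Fin 3)) i => (1 / ‖x i‖ ^ 2) • x i) '' tsupport ψ := by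
  exact closure_minimal (fun x hx => sctA_transport_support Δ hψs hx) (sctA_image_tsupport hψc hψs).1.isClosed

/-- The transported test function has compact support. -/
theorem sctA_transport_hasCompactSupport {n : ℕ} (Δ : ℝ) {ψ : (Fin n → EuclideanSpace ℝ (Fin 3)) → ℝ}
    (hψc : HasCompactSupport ψ) (hψs : tsupport ψ ⊆ {x | ∀ i, x i ≠ 0}) :
    HasCompactSupport (fun x : Fin n → EuclideanSpace ℝ (Fin 3) =>
        (∏ j, (‖x j‖ ^ 2) ^ (Δ - 3)) * ψ (fun i => (1 / ‖x i‖ ^ 2) • x i)) :=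
  (sctA_image_tsupport hψc hψs).1.of_isClosed_subset (isClosed_tsupport _)
    (sctA_transport_tsupport Δ hψc hψs)

/-- The transported test function vanishes near every configuration through the origin. -/
theorem sctA_transport_eventuallyEq_zero {n : ℕ} (Δ : ℝ) {ψ : (Fin n → EuclideanSpace ℝ (Fin 3)) → ℝ}
    (hψc : HasCompactSupport ψ) (hψs : tsupport ψ ⊆ {x | ∀ i, x i ≠ 0})
    {x : Fin n → EuclideanSpace ℝ (Fin 3)} (hx : ¬ ∀ i, x i ≠ 0) :
    (fun x : Fin n → EuclideanSpace ℝ (Fin 3) =>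
        (∏ j, (‖x j‖ ^ 2) ^ (Δ - 3)) * ψ (fun i => (1 / ‖x i‖ ^ 2) • x i)) =ᶠ[𝓝 x] 0 := by
  rw [← notMem_tsupport_iff_eventuallyEq]
  intro h
  exact hx ((sctA_image_tsupport hψc hψs).2 (sctA_transport_tsupport Δ hψc hψs h))

/-- The transported test function is smooth. -/
theorem sctA_transport_contDiff {n : ℕ} (Δ : ℝ) {ψ : (Fin n → EuclideanSpace ℝ (Fin 3)) → ℝ}
    (hψ : ContDiff ℝ ((⊤ : ℕ∞) : WithTop ℕ∞) ψ) (hψc : HasCompactSupport ψ)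
    (hψs : tsupport ψ ⊆ {x | ∀ i, x i ≠ 0}) :
    ContDiff ℝ ((⊤ : ℕ∞) : WithTop ℕ∞) (fun x : Fin n → EuclideanSpace ℝ (Fin 3) =>
        (∏ j, (‖x j‖ ^ 2) ^ (Δ - 3)) * ψ (fun i => (1 / ‖x i‖ ^ 2) • x i)) := by
  refine contDiff_iff_contDiffAt.2 fun x => ?_
  by_cases hx : ∀ i, x i ≠ 0
  · exact (sctA_contDiffAt_weight (Δ - 3) hx).mul (hψ.contDiffAt.comp x (sctA_contDiffAt_prodInv hx))
  · exact (contDiffAt_const (c := (0 : ℝ))).congr_of_eventuallyEq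
      (sctA_transport_eventuallyEq_zero Δ hψc hψs hx)

/-- The pointwise transport identity at every configuration (both sides vanish at configurations
through the origin). -/
theorem sctA_transport_pointwise_all (n : ℕ) (Δ : ℝ) (a : EuclideanSpace ℝ (Fin 3))
    {ψ : (Fin n → EuclideanSpace ℝ (Fin 3)) → ℝ} (hψ : ContDiff ℝ ((⊤ : ℕ∞) : WithTop ℕ∞) ψ)
    (hψc : HasCompactSupport ψ) (hψs : tsupport ψ ⊆ {x | ∀ i, x i ≠ 0})
    (x : Fin n → EuclideanSpace ℝ (Fin 3)) :
    (2 * Δ - 6) * (∑ i, inner ℝ a (x i)) *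
        ((∏ j, (‖x j‖ ^ 2) ^ (Δ - 3)) * ψ (fun i => (1 / ‖x i‖ ^ 2) • x i)) +
      fderiv ℝ (fun y : Fin n → EuclideanSpace ℝ (Fin 3) =>
        (∏ j, (‖y j‖ ^ 2) ^ (Δ - 3)) * ψ (fun i => (1 / ‖y i‖ ^ 2) • y i)) x
        (fun i => ‖x i‖ ^ 2 • a - (2 * inner ℝ a (x i)) • x i) =
      (∏ j, (‖x j‖ ^ 2) ^ (Δ - 3)) *
        fderiv ℝ ψ (fun i => (1 / ‖x i‖ ^ 2) • x i) (fun _ => a) := by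
  by_cases hx : ∀ i, x i ≠ 0
  · exact sctA_transport_pointwise n Δ a (hψ.differentiable (by simp)) hx
  · have h0 := sctA_transport_eventuallyEq_zero Δ hψc hψs hx
    have hφx : (∏ j, (‖x j‖ ^ 2) ^ (Δ - 3)) * ψ (fun i => (1 / ‖x i‖ ^ 2) • x i) = 0 := h0.eq_of_nhds
    have hψ' : fderiv ℝ ψ (fun i => (1 / ‖x i‖ ^ 2) • x i) = 0 := by
      apply fderiv_of_notMem_tsupport
      intro h
      exact sctA_prodInv_not_mem hx (hψs h)
    rw [h0.fderiv_eq, hφx, hψ']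
    simp

/-! ## The weak translation identity for `T = (∏ (‖yⱼ‖²)^(−Δ)) · S ∘ Φ` (`K = ιPι`, integrated) -/

/-- `Φ` maps non-coincident off-origin configurations to non-coincident configurations. -/
theorem sctA_prodInv_mem_nonCoincident {n : ℕ} {x : Fin n → EuclideanSpace ℝ (Fin 3)}
    (hx : x ∈ NonCoincident 3 n) :
    (fun i => (1 / ‖x i‖ ^ 2) • x i) ∈ NonCoincident 3 n := by
  rw [mem_nonCoincident] at hx ⊢
  intro i j hij
  exact hx (sphereInversion_injective one_ne_zero hij)

/-- The pointwise weight bookkeeping of the change of variables: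
`(∏ (1/‖yⱼ‖²)³) · ∏ (‖Φ yⱼ‖²)^(Δ−3) = ∏ (‖yⱼ‖²)^(−Δ)` off the origin. -/
theorem sctA_weight_change {n : ℕ} (Δ : ℝ) {y : Fin n → EuclideanSpace ℝ (Fin 3)} (hy : ∀ i, y i ≠ 0) :
    (∏ i, (1 / ‖y i‖ ^ 2) ^ 3) * ∏ j, (‖(1 / ‖y j‖ ^ 2) • y j‖ ^ 2) ^ (Δ - 3) =
      ∏ j, (‖y j‖ ^ 2) ^ (-Δ) := by
  rw [← Finset.prod_mul_distrib]
  refine Finset.prod_congr rfl fun j _ => ?_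
  have hr : (0 : ℝ) < ‖y j‖ ^ 2 := by have := norm_pos_iff.2 (hy j); positivity
  have hq : (0 : ℝ) < 1 / ‖y j‖ ^ 2 := one_div_pos.2 hr
  rw [norm_sphereInversion one_pos (hy j),
    show ((1 : ℝ) / ‖y j‖) ^ 2 = 1 / ‖y j‖ ^ 2 by rw [div_pow, one_pow],
    show ((1 : ℝ) / ‖y j‖ ^ 2) ^ (3 : ℕ) = (1 / ‖y j‖ ^ 2) ^ ((3 : ℕ) : ℝ) from (Real.rpow_natCast _ 3).symm,
    ← Real.rpow_add hq, show ((3 : ℕ) : ℝ) + (Δ - 3) = Δ by push_cast; ring,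
    one_div, Real.inv_rpow hr.le, Real.rpow_neg hr.le]

/-- **Weak translation identity (`K = ιPι`).** If `S_n` satisfies the weak special-conformal Ward
identity (for all directions `b` and all smooth tests compactly supported in `NonCoincident`), then
`T(y) = (∏ (‖yⱼ‖²)^(−Δ)) S_n(Φ y)` satisfies `∫ T(y) Dψ(y)[(a,…,a)] dy = 0` for every smooth `ψ` compactly
supported in the off-origin non-coincident configurations. -/
theorem sctA_weak_translation :
    ∀ (S : CorrFamily 3) (Δ : ℝ) (n : ℕ) (a : EuclideanSpace ℝ (Fin 3)),
      (∀ (b : EuclideanSpace ℝ (Fin 3)) (φ : (Fin n → EuclideanSpace ℝ (Fin 3)) → ℝ),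
        ContDiff ℝ ((⊤ : ℕ∞) : WithTop ℕ∞) φ → HasCompactSupport φ → tsupport φ ⊆ NonCoincident 3 n →
        ∫ x, S n x * ((2 * Δ - 6) * (∑ i, inner ℝ b (x i)) * φ x +
          fderiv ℝ φ x (fun i => ‖x i‖ ^ 2 • b - (2 * inner ℝ b (x i)) • x i)) = 0) →
      ∀ (ψ : (Fin n → EuclideanSpace ℝ (Fin 3)) → ℝ), ContDiff ℝ ((⊤ : ℕ∞) : WithTop ℕ∞) ψ →
        HasCompactSupport ψ → tsupport ψ ⊆ {x | ∀ i, x i ≠ 0} → tsupport ψ ⊆ NonCoincident 3 n →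
        ∫ y, ((∏ j, (‖y j‖ ^ 2) ^ (-Δ)) * S n (fun i => (1 / ‖y i‖ ^ 2) • y i)) *
          fderiv ℝ ψ y (fun _ => a) = 0 := by
  intro S Δ n a hK ψ hψ hψc hψs hψs'
  have hφs : tsupport (fun x : Fin n → EuclideanSpace ℝ (Fin 3) =>
      (∏ j, (‖x j‖ ^ 2) ^ (Δ - 3)) * ψ (fun i => (1 / ‖x i‖ ^ 2) • x i)) ⊆ NonCoincident 3 n := by
    refine (sctA_transport_tsupport Δ hψc hψs).trans ?_
    rintro _ ⟨z, hz, rfl⟩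
    exact sctA_prodInv_mem_nonCoincident (hψs' hz)
  have h1 := hK a _ (sctA_transport_contDiff Δ hψ hψc hψs) (sctA_transport_hasCompactSupport Δ hψc hψs) hφs
  have h2 : ∫ x, S n x * ((∏ j, (‖x j‖ ^ 2) ^ (Δ - 3)) *
      fderiv ℝ ψ (fun i => (1 / ‖x i‖ ^ 2) • x i) (fun _ => a)) = 0 := by
    rw [← h1]
    refine integral_congr_ae (Filter.Eventually.of_forall fun x => ?_)
    simp only
    rw [sctA_transport_pointwise_all n Δ a hψ hψc hψs x]
  have hDψ : ∀ y : Fin n → EuclideanSpace ℝ (Fin 3), (¬ ∀ i, y i ≠ 0) → fderiv ℝ ψ y = 0 :=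
    fun y hy => fderiv_of_notMem_tsupport ℝ fun h => hy (hψs h)
  rw [← h2]  -- change of variables `x = Φ y` on the off-origin configurations
  symm
  refine integral_eq_of_setIntegral_forall_ne_zero _ _ (fun x hx => ?_) (fun y hy => ?_) ?_
  · have hx' : ¬ ∀ i, x i ≠ 0 := hx
    rw [hDψ _ (sctA_prodInv_not_mem hx'), _root_.zero_apply, mul_zero, mul_zero]
  · have hy' : ¬ ∀ i, y i ≠ 0 := hy
    rw [hDψ _ hy', _root_.zero_apply, mul_zero]
  rw [setIntegral_comp_prodSphereInversion n one_pos]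
  refine setIntegral_congr_fun (isOpen_forall_ne_zero n).measurableSet fun y hy => ?_
  have hy' : ∀ i, y i ≠ 0 := hy
  simp only
  rw [sctA_prodInv_prodInv hy', ← sctA_weight_change Δ hy']
  ring

end Summit.CriticalPhenomena.Ising3DConformalLimit.PrecisionLaplacianMoebiusLimitOfTwoPointLaw

end
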